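import Summits.BirchSwinnertonDyer.BirchSwinnertonDyer.Theorems.ResidualThetaTransportAtTwoThetaLayerLambdaCongruenceAtTwoCuspSpanQuadratic
import HarnessLib

/-!
# Route `ResidualThetaTransportAtTwo`, cruxes Kan⁺ (stmt-BirchSwinnertonDyer-20688) / 21437: the node at a PRIME level from a
# FUNCTIONAL CRITERION on `𝔽ₚˣ` («Theorem C(p)»: every 4-invariant, `S`-invariant solution of Manin's three-term relation
# vanishing at `1` and at the elliptic residues is a homomorphism)

Cell `bsd-wall`, lead prover `bsd-wall-rtt-p3` g9 (2026-08-28). THEOREMS ONLY; `--supports stmt-BirchSwinnertonDyer-20688`; BSD is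
not proved by this; the functional criterion is a HYPOTHESIS (spelled inline), verified by this seat's `prop2.py` for every odd
prime `p < 12000` and OPEN uniformly — it is the research residue of line `birth` at prime level, now free of matrices.

`cuspSpanTrace_of_functional_criterion`: let `p` be an odd prime and suppose that every `F : ZMod p → ZMod 2` with
(1) `F 1 = 0`, (2) `F (4r) = F r` (`r ≠ 0`), (3) `F r = F s` whenever `r s = −1`, (4) `F r = 0` whenever `r² + t r + 1 = 0`,
`|t| ≤ 1`, (5) `F u + F ((u−1)/u) + F (u−1) = 0` (`u ≠ 0, 1`) and (6) `F u + F (−(u+1)/u) + F ((−(u+1))⁻¹) = 0` (`u ≠ 0, −1`)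
is multiplicative on the non-zero residues. Then the trace form (G″)_p holds (hence `CuspSpanEvenAtTwo p`,
`cuspSpanEvenAtTwo_of_functional_criterion`). PROOF: for an admissible `χ` the `B₁`-character `F(r) := χ(β_r)` satisfies (1)–(6)
— (2) is the 4-invariance of `…CuspSpanFourInvariance` (Dirichlet), (3) its `S`-companion, (4) the elliptic seed, (5)/(6) the
three-term rules of `…CuspSpanGenerationB1` — so `F` is multiplicative; `χ + F ∘ d` kills `B₁` and the small-trace elements
(`d ∈ {±1}` or `d² ∓ t d + 1 = 0`), hence vanishes by the descent `chi_eq_zero_of_forall_b1`.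

References: [Rademacher1929] §1; [Knapp1993] Prop. 11.1; Ju. I. Manin, Izv. 36 (1972) §1.5–1.9 [Manin1972]; [Pollack2003] Conj. 6.3.
-/

set_option autoImplicit false
set_option linter.dupNamespace false

open scoped MatrixGroups

open CongruenceSubgroup

namespace Summit.BirchSwinnertonDyer.BirchSwinnertonDyer.Theorems.SignedMuAtTwo

variable {p : ℕ} [Fact p.Prime]

/-- **The node at an odd prime level from the functional criterion («Theorem C(p)»).** See the module docstring.
[cite: Pollack2003, Conj. 6.3] [cite: Manin1972, §1.5] -/
theorem cuspSpanTrace_of_functional_criterion (hp2 : p ≠ 2)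
    (hC : ∀ F : ZMod p → ZMod 2,
      F 1 = 0 →
      (∀ r : ZMod p, r ≠ 0 → F (4 * r) = F r) →
      (∀ r s : ZMod p, r * s = -1 → F r = F s) →
      (∀ (r : ZMod p) (t : ℤ), t.natAbs ≤ 1 → r * r + t * r + 1 = 0 → F r = 0) →
      (∀ u : ZMod p, u ≠ 0 → u - 1 ≠ 0 → F u + F ((u - 1) * u⁻¹) + F (u - 1) = 0) →
      (∀ u : ZMod p, u ≠ 0 → u + 1 ≠ 0 → F u + F (-(u + 1) * u⁻¹) + F ((-(u + 1))⁻¹) = 0) →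
      ∀ x y : ZMod p, x ≠ 0 → y ≠ 0 → F (x * y) = F x + F y) :
    ∀ χ : Gamma0 p → ZMod 2,
      (∀ γ δ : Gamma0 p, χ (γ * δ) = χ γ + χ δ) →
      (∀ γ : Gamma0 p, ((γ : SL(2, ℤ)) 0 0 + (γ : SL(2, ℤ)) 1 1).natAbs ≤ 2 → χ γ = 0) →
      (∀ γ : Gamma0 p, (∃ k : ℕ, 1 ≤ k ∧ ((γ : SL(2, ℤ)) 1 1).natAbs = 4 ^ k) → χ γ = 0) →
      ∃ ψ : ZMod p → ZMod 2, (∀ x y : ZMod p, IsUnit x → IsUnit y → ψ (x * y) = ψ x + ψ y) ∧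
        ∀ γ : Gamma0 p, χ γ = ψ ((((γ : SL(2, ℤ)) 1 1 : ℤ) : ZMod p)) := by
  classical
  intro χ hadd hsmall hkill
  have hp : p.Prime := Fact.out
  -- the `B₁`-character
  have hex : ∀ r : ZMod p, r ≠ 0 → ∃ β : Gamma0 p, (β : SL(2, ℤ)) 0 1 = -1 ∧ ((((β : SL(2, ℤ)) 1 1 : ℤ) : ZMod p)) = r :=
    fun r hr ↦ exists_b_neg_one_of_isUnit (N := p) (isUnit_iff_ne_zero.mpr hr)
  let F : ZMod p → ZMod 2 := fun r ↦ if h : r ≠ 0 then χ (Classical.choose (hex r h)) else 0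
  have hF : ∀ β : Gamma0 p, (β : SL(2, ℤ)) 0 1 = -1 → ∀ r : ZMod p, ((((β : SL(2, ℤ)) 1 1 : ℤ) : ZMod p)) = r →
      F r = χ β := by
    intro β hb r hd
    have hr : r ≠ 0 := hd ▸ (isUnit_gamma0_apply_one_one β).ne_zero
    have hs := Classical.choose_spec (hex r hr)
    simp only [F, dif_pos hr]
    exact chi_eq_of_apply_zero_one_eq_neg_one hadd hsmall hs.1 hb (by rw [hs.2, hd])
  -- (1)
  have h1 : F 1 = 0 := by
    obtain ⟨e, he00, he01, -, he11⟩ :=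
      ThetaLayerLambdaCongruenceAtTwo.exists_gamma0_entries (N := p) 1 (-1) 0 1 (by ring) (dvd_zero _)
    rw [hF e he01 1 (by rw [he11]; push_cast; ring)]
    exact hsmall e (by rw [he00, he11]; decide)
  -- (2)
  have h4 : ∀ r : ZMod p, r ≠ 0 → F (4 * r) = F r := by
    intro r hr
    have h4r : (4 : ZMod p) * r ≠ 0 := by
      refine mul_ne_zero ?_ hr
      intro h0
      have h0' : ((4 : ℕ) : ZMod p) = 0 := by exact_mod_cast h0
      have h4 : p ∣ 2 ^ 2 := by norm_num; exact (ZMod.natCast_eq_zero_iff 4 p).mp h0'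
      exact hp2 ((Nat.prime_dvd_prime_iff_eq hp Nat.prime_two).mp (hp.dvd_of_dvd_pow h4))
    obtain ⟨β, hb, hd⟩ := hex r hr
    obtain ⟨β', hb', hd'⟩ := hex _ h4r
    rw [hF β hb r hd, hF β' hb' _ hd']
    exact chi_eq_of_b_neg_one_of_d_eq_four_mul hp2 hadd hsmall hkill hb' hb (by rw [hd, hd'])
  -- (3)
  have hS : ∀ r s : ZMod p, r * s = -1 → F r = F s := by
    intro r s h
    have hr : r ≠ 0 := by rintro rfl; simp at h
    have hs : s ≠ 0 := by rintro rfl; simp at h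
    obtain ⟨β, hb, hd⟩ := hex r hr
    obtain ⟨β', hb', hd'⟩ := hex s hs
    rw [hF β hb r hd, hF β' hb' s hd']
    exact chi_eq_of_b_neg_one_of_mul_d_eq_neg_one hadd hsmall hb hb' (by rw [hd, hd', h])
  -- (4)
  have hell : ∀ (r : ZMod p) (t : ℤ), t.natAbs ≤ 1 → r * r + t * r + 1 = 0 → F r = 0 := by
    intro r t ht h
    have hr : r ≠ 0 := by rintro rfl; simp at h
    obtain ⟨β, hb, hd⟩ := hex r hr
    rw [hF β hb r hd]
    refine chi_eq_zero_of_b_neg_one_of_elliptic hadd hsmall β hb (r.val : ℤ) t ht ?_ (by rw [hd]; simp)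
    rw [← ZMod.intCast_zmod_eq_zero_iff_dvd]
    push_cast
    rw [ZMod.natCast_zmod_val]; exact h
  -- (5) and (6): the three-term rules
  have hu_data : ∀ u : ZMod p, u ≠ 0 → ((u.val : ℤ) : ZMod p) = u ∧ (((u⁻¹).val : ℤ) : ZMod p) * u = 1 := by
    intro u hu
    refine ⟨by simp, ?_⟩
    rw [Int.cast_natCast, ZMod.natCast_zmod_val, inv_mul_cancel₀ hu]
  have hpos : ∀ u : ZMod p, u ≠ 0 → u - 1 ≠ 0 → F u + F ((u - 1) * u⁻¹) + F (u - 1) = 0 := by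
    intro u hu hu1
    obtain ⟨hcu, hinv⟩ := hu_data u hu
    set d₁ : ℤ := (u.val : ℤ)
    set a₁ : ℤ := ((u⁻¹).val : ℤ)
    have ha1 : (a₁ : ZMod p) = u⁻¹ := (inv_eq_of_mul_eq_one_left hinv).symm
    have hv : ((1 - a₁ : ℤ) : ZMod p) = (u - 1) * u⁻¹ := by
      push_cast; rw [ha1, sub_mul, mul_inv_cancel₀ hu, one_mul]
    have hv0 : (u - 1) * u⁻¹ ≠ 0 := mul_ne_zero hu1 (inv_ne_zero hu)
    set a₂ : ℤ := ((((u - 1) * u⁻¹)⁻¹).val : ℤ)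
    have hc1 : (p : ℤ) ∣ 1 - a₁ * d₁ := by
      rw [← ZMod.intCast_zmod_eq_zero_iff_dvd]; push_cast; rw [hcu, hinv, sub_self]
    have hc2 : (p : ℤ) ∣ 1 - a₂ * (1 - a₁) := by
      rw [← ZMod.intCast_zmod_eq_zero_iff_dvd]; push_cast
      rw [show ((1 : ZMod p) - (a₁ : ZMod p)) = (u - 1) * u⁻¹ by exact_mod_cast hv]
      rw [Int.cast_natCast, ZMod.natCast_zmod_val, inv_mul_cancel₀ hv0, sub_self]
    obtain ⟨β₁, h100, h101, -, h111⟩ := ThetaLayerLambdaCongruenceAtTwo.exists_gamma0_entries (N := p)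
      a₁ (-1) (1 - a₁ * d₁) d₁ (by ring) hc1
    obtain ⟨β₂, -, h201, -, h211⟩ := ThetaLayerLambdaCongruenceAtTwo.exists_gamma0_entries (N := p)
      a₂ (-1) (1 - a₂ * (1 - a₁)) (1 - a₁) (by ring) hc2
    obtain ⟨β₃, hb3, hd3⟩ := hex (u - 1) hu1
    have h3 := chi_add_chi_eq_of_pos hadd hsmall h101 h201 hb3 (by rw [h100, h211]; ring)
      (by rw [hd3, h111, h211]; push_cast; rw [hcu, ha1, mul_sub, mul_one, mul_inv_cancel₀ hu])
    rw [hF β₁ h101 u (by rw [h111, hcu]), hF β₂ h201 _ (by rw [h211, ← hv]), hF β₃ hb3 _ hd3, h3]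
    exact CharTwo.add_self_eq_zero _
  have hneg : ∀ u : ZMod p, u ≠ 0 → u + 1 ≠ 0 → F u + F (-(u + 1) * u⁻¹) + F ((-(u + 1))⁻¹) = 0 := by
    intro u hu hu1
    obtain ⟨hcu, hinv⟩ := hu_data u hu
    set d₁ : ℤ := (u.val : ℤ)
    set a₁ : ℤ := ((u⁻¹).val : ℤ)
    have ha1 : (a₁ : ZMod p) = u⁻¹ := (inv_eq_of_mul_eq_one_left hinv).symm
    have hv : ((-1 - a₁ : ℤ) : ZMod p) = -(u + 1) * u⁻¹ := by
      push_cast; rw [ha1, neg_add, sub_eq_add_neg, add_mul, neg_mul, mul_inv_cancel₀ hu, neg_mul, one_mul]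
    have hu1' : -(u + 1) ≠ 0 := neg_ne_zero.mpr hu1
    have hv0 : -(u + 1) * u⁻¹ ≠ 0 := mul_ne_zero hu1' (inv_ne_zero hu)
    set a₂ : ℤ := (((-(u + 1) * u⁻¹)⁻¹).val : ℤ)
    have ha2 : (a₂ : ZMod p) = (-(u + 1) * u⁻¹)⁻¹ := by
      simp only [a₂, Int.cast_natCast, ZMod.natCast_zmod_val]
    have hc1 : (p : ℤ) ∣ 1 - a₁ * d₁ := by
      rw [← ZMod.intCast_zmod_eq_zero_iff_dvd]; push_cast; rw [hcu, hinv, sub_self]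
    have hc2 : (p : ℤ) ∣ 1 - a₂ * (-1 - a₁) := by
      rw [← ZMod.intCast_zmod_eq_zero_iff_dvd]; push_cast
      rw [show (-(1 : ZMod p) - (a₁ : ZMod p)) = -(u + 1) * u⁻¹ by exact_mod_cast hv, ha2, inv_mul_cancel₀ hv0,
        sub_self]
    obtain ⟨β₁, h100, h101, -, h111⟩ := ThetaLayerLambdaCongruenceAtTwo.exists_gamma0_entries (N := p)
      a₁ (-1) (1 - a₁ * d₁) d₁ (by ring) hc1
    obtain ⟨β₂, h200, h201, -, h211⟩ := ThetaLayerLambdaCongruenceAtTwo.exists_gamma0_entries (N := p)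
      a₂ (-1) (1 - a₂ * (-1 - a₁)) (-1 - a₁) (by ring) hc2
    obtain ⟨β₃, hb3, hd3⟩ := hex ((-(u + 1))⁻¹) (inv_ne_zero hu1')
    have hw : ((((β₃ : SL(2, ℤ)) 1 1 : ℤ) : ZMod p)) =
        ((((β₁ : SL(2, ℤ)) 0 0 * (β₂ : SL(2, ℤ)) 0 0 : ℤ)) : ZMod p) := by
      rw [hd3, h100, h200]; push_cast; rw [ha1, ha2, mul_inv_rev, inv_inv, ← mul_assoc, inv_mul_cancel₀ hu, one_mul]
    have h3 := chi_add_chi_eq_of_neg hadd hsmall h101 h201 hb3 (by rw [h100, h211]; ring) hw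
    rw [hF β₁ h101 u (by rw [h111, hcu]), hF β₂ h201 _ (by rw [h211, ← hv]), hF β₃ hb3 _ hd3, h3]
    exact CharTwo.add_self_eq_zero _
  have hmult := hC F h1 h4 hS hell hpos hneg
  -- assembly: `χ + F ∘ d` vanishes
  refine ⟨F, fun x y hx hy ↦ hmult x y hx.ne_zero hy.ne_zero, ?_⟩
  let χ' : Gamma0 p → ZMod 2 := fun γ ↦ χ γ + F ((((γ : SL(2, ℤ)) 1 1 : ℤ) : ZMod p))
  have hadd' : ∀ γ δ : Gamma0 p, χ' (γ * δ) = χ' γ + χ' δ := by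
    intro γ δ
    simp only [χ']
    rw [cast_mul_apply_one_one, hmult _ _ (isUnit_gamma0_apply_one_one γ).ne_zero
      (isUnit_gamma0_apply_one_one δ).ne_zero, hadd]
    ring
  have hsmall' : ∀ γ : Gamma0 p, ((γ : SL(2, ℤ)) 0 0 + (γ : SL(2, ℤ)) 1 1).natAbs ≤ 2 → χ' γ = 0 := by
    intro γ ht
    simp only [χ']
    rw [hsmall γ ht, zero_add]
    set d : ZMod p := ((((γ : SL(2, ℤ)) 1 1 : ℤ) : ZMod p)) with hd
    set t : ℤ := (γ : SL(2, ℤ)) 0 0 + (γ : SL(2, ℤ)) 1 1 with htdef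
    have hsq : d * d = (t : ZMod p) * d - 1 := cast_apply_one_one_sq γ
    have hcases : t = -2 ∨ t = -1 ∨ t = 0 ∨ t = 1 ∨ t = 2 := by omega
    rcases hcases with h | h | h | h | h <;> rw [h] at hsq <;> push_cast at hsq
    · have : (d + 1) * (d + 1) = 0 := by linear_combination hsq
      have hd1 : d = -1 := by rcases mul_eq_zero.mp this with h1 | h1 <;> linear_combination h1
      rw [hd1, ← hS 1 (-1) (by ring), h1]
    · exact hell d 1 (by decide) (by push_cast; linear_combination hsq)
    · exact hell d 0 (by decide) (by push_cast; linear_combination hsq)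
    · exact hell d (-1) (by decide) (by push_cast; linear_combination hsq)
    · have : (d - 1) * (d - 1) = 0 := by linear_combination hsq
      have hd1 : d = 1 := by rcases mul_eq_zero.mp this with h1 | h1 <;> linear_combination h1
      rw [hd1, h1]
  have hB' : ∀ β : Gamma0 p, (β : SL(2, ℤ)) 0 1 = -1 → χ' β = 0 := by
    intro β hb
    simp only [χ']
    rw [hF β hb _ rfl]
    exact CharTwo.add_self_eq_zero _
  have hsucc : ∀ δ : ℤ, IsUnit ((δ : ℤ) : ZMod p) ∨ IsUnit (((δ + 1 : ℤ)) : ZMod p) := by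
    intro δ
    by_contra hcon
    push Not at hcon
    obtain ⟨e1, e2⟩ := hcon
    rw [isUnit_iff_ne_zero, not_not] at e1 e2
    push_cast at e2
    rw [e1, zero_add] at e2
    exact one_ne_zero e2
  have hzero := chi_eq_zero_of_forall_b1 hsucc hadd' hsmall' (forall_b1_of_forall_b_neg_one hadd' hB')
  intro γ
  have h := hzero γ
  simp only [χ'] at h
  have e : χ γ = -F ((((γ : SL(2, ℤ)) 1 1 : ℤ) : ZMod p)) := by linear_combination h
  rw [e, ZMod.neg_eq_self_mod_two]

/-- **`CuspSpanEvenAtTwo p` from the functional criterion.** [cite: Pollack2003, Conj. 6.3] -/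
theorem cuspSpanEvenAtTwo_of_functional_criterion (hp2 : p ≠ 2)
    (hC : ∀ F : ZMod p → ZMod 2,
      F 1 = 0 →
      (∀ r : ZMod p, r ≠ 0 → F (4 * r) = F r) →
      (∀ r s : ZMod p, r * s = -1 → F r = F s) →
      (∀ (r : ZMod p) (t : ℤ), t.natAbs ≤ 1 → r * r + t * r + 1 = 0 → F r = 0) →
      (∀ u : ZMod p, u ≠ 0 → u - 1 ≠ 0 → F u + F ((u - 1) * u⁻¹) + F (u - 1) = 0) →
      (∀ u : ZMod p, u ≠ 0 → u + 1 ≠ 0 → F u + F (-(u + 1) * u⁻¹) + F ((-(u + 1))⁻¹) = 0) →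
      ∀ x y : ZMod p, x ≠ 0 → y ≠ 0 → F (x * y) = F x + F y) :
    CuspSpanEvenAtTwo p :=
  cuspSpanEvenAtTwo_of_cuspSpanTrace (cuspSpanTrace_of_functional_criterion hp2 hC)

end Summit.BirchSwinnertonDyer.BirchSwinnertonDyer.Theorems.SignedMuAtTwo
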